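import Summits.ValiantsHypothesis.ValiantsHypothesis.Theorems.BarrierLeverPartitionMinorsHitByVPAdditiveSplit

/-!
# Route BarrierLever — item `PartitionMinorsHitByVP` (stmt-ValiantsHypothesis-19717):
# a LIMIT of the additive door — size-≤ 1 columns × affinely dependent rows are dead for every table

Helper file (`--supports stmt-ValiantsHypothesis-19717`; cell valiant-natproofs, rung V4, 𝒟-side door (c),
prover seat val-np-p1, gen 10). Closes NO item; definition-free NEGATIVE complement of engine v4
(`…AdditiveSplit`), recording where the additive / subset-sum door (`AdditiveDoor.partitionMinor_hit_of_additive_mem`)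
provably cannot go, so that the certificate calculus is known to be EXACT on this test class.

**Theorem (`det_additive_eq_zero_of_card_le_one`).** If every column set has `|w j| ≤ 1` and the row sets are
AFFINELY DEPENDENT (a nonzero `v : ι → R` with `Σ_i v i = 0` and `Σ_{i : a ∈ u i} v i = 0` for every coordinate
`a`), then for EVERY table `(ω₀, ω)` over any integral domain `R` the additive matrix
`[∏_{c ∈ w j} (ω₀ c + Σ_{a ∈ u i} ω a c)]_{i,j}` has determinant `0`: its rows satisfy the same dependency
(`v ᵥ* M = 0`), because each entry is an affine function of the indicator vector of `u i`.
Example (`det_additive_eq_zero_square_singletons`): rows `∅, {0}, {1}, {0,1}` (a 2-face, `v = (1,−1,−1,1)`)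
× any four columns of size `≤ 1`, in every dimension `h ≥ 3`.

By contrast engine v4 certifies «size-≤ 1 columns × affinely INdependent rows» (a flag of exact hyperplane
sections exists), so on this class the additive door's domain is decided exactly. Such layouts are small
(`r ≤ h + 1`) and are hit by sparse witnesses (`partitionMinor_hit_of_card_le`); the point is only the door's
limit. WHAT THIS IS NOT: no statement about item 19717 itself (which allows other witnesses); nothing on CPM,
crux 14610 or VP vs VNP.
-/

set_option linter.dupNamespace false

namespace Summit.ValiantsHypothesis.ValiantsHypothesis.Theorems.BarrierLever.SubsetSum

open Finset

variable {h : ℕ}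

/-- **Size-≤ 1 columns × affinely dependent rows: the additive matrix is singular for every table.** -/
theorem det_additive_eq_zero_of_card_le_one {R : Type*} [CommRing R] [IsDomain R] {ι : Type*} [Fintype ι]
    [DecidableEq ι] (u w : ι → Finset (Fin h)) (hw : ∀ j, (w j).card ≤ 1)
    (v : ι → R) (hv : v ≠ 0) (h1 : ∑ i, v i = 0)
    (h2 : ∀ a : Fin h, ∑ i, (if a ∈ u i then v i else 0) = 0)
    (ω₀ : Fin h → R) (ω : Fin h → Fin h → R) :
    (Matrix.of fun i j : ι => ∏ c ∈ w j, (ω₀ c + ∑ a ∈ u i, ω a c)).det = 0 := by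
  refine Matrix.exists_vecMul_eq_zero_iff.mp ⟨v, hv, ?_⟩
  ext j
  rw [Matrix.vecMul, dotProduct, Pi.zero_apply]
  simp only [Matrix.of_apply]
  -- a column of size ≤ 1 is empty or a singleton
  rcases Nat.le_one_iff_eq_zero_or_eq_one.mp (hw j) with hj | hj
  · rw [Finset.card_eq_zero.mp hj]
    simp only [Finset.prod_empty, mul_one]
    exact h1
  · obtain ⟨c, hc⟩ := Finset.card_eq_one.mp hj
    have hsum : ∀ i, ∑ a ∈ u i, ω a c = ∑ a, if a ∈ u i then ω a c else 0 := fun i => by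
      rw [← Finset.sum_filter, Finset.filter_univ_mem]
    simp_rw [hc, Finset.prod_singleton, hsum, mul_add, Finset.mul_sum]
    rw [Finset.sum_add_distrib, ← Finset.sum_mul, h1, zero_mul, zero_add, Finset.sum_comm]
    refine Finset.sum_eq_zero fun a _ => ?_
    have hva : ∀ i, v i * (if a ∈ u i then ω a c else 0) = (if a ∈ u i then v i else 0) * ω a c := by
      intro i; split_ifs <;> simp
    simp_rw [hva]
    rw [← Finset.sum_mul, h2 a, zero_mul]

/-- **Example: the 2-face rows `∅, {a}, {b}, {a,b}` × any four columns of size `≤ 1`** are dead for the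
additive door (every table), although the rows are as simple as can be. -/
theorem det_additive_eq_zero_square_singletons {R : Type*} [CommRing R] [IsDomain R] (a b : Fin h) (hab : a ≠ b)
    (w : Fin 4 → Finset (Fin h)) (hw : ∀ j, (w j).card ≤ 1) (ω₀ : Fin h → R) (ω : Fin h → Fin h → R) :
    (Matrix.of fun i j : Fin 4 => ∏ c ∈ w j, (ω₀ c + ∑ x ∈ (![∅, {a}, {b}, {a, b}] : Fin 4 → Finset (Fin h)) i,
      ω x c)).det = 0 := by
  refine det_additive_eq_zero_of_card_le_one _ w hw ![1, -1, -1, 1] ?_ ?_ ?_ ω₀ ω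
  · intro h0
    have := congrFun h0 0
    simp only [Matrix.cons_val_zero, Pi.zero_apply] at this
    exact one_ne_zero this
  · simp [Fin.sum_univ_four]
  · intro x
    rw [Fin.sum_univ_four]
    by_cases hxa : x = a
    · subst hxa
      simp [hab]
    · by_cases hxb : x = b
      · subst hxb
        simp [hxa]
      · simp [hxa, hxb]

end Summit.ValiantsHypothesis.ValiantsHypothesis.Theorems.BarrierLever.SubsetSum
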